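import Mathlib
import Summits.MatrixMultiplication.MatrixMultiplication.Theses.PauliSmithLocalisation

/-!
# `PauliSmithLocalisation.Assembly` (stmt-MatrixMultiplication-9881) — proved

The assembly item of route `MatrixMultiplication/PauliSmithLocalisation` (refutation line) is the
implication `SmithPhaseGap → SuperquadraticInfinitelyOften → ¬ MatrixMultiplication`:
a Smith phase gap `p^((2+δ)k) < bR(⟨p^k,p^k,p^k⟩)` for all large `k` (some prime `p`, some `δ > 0`)
feeds the shared glue item `SuperquadraticInfinitelyOften` (an infinitely-often superquadratic RANK
lower bound refutes `ω(ℂ) = 2`), because border rank is at most rank.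

Proof (self-contained, a few lines of logic; it follows — but does not invoke — the route file's
deciding theorem `closes`): `SmithPhaseGap` gives `p, δ, k₀`; for any `n₀` put `n := p^(max k₀ n₀)`,
so `n₀ ≤ max k₀ n₀ < p^(max k₀ n₀) = n` (`Nat.lt_pow_self`, `p > 1`), and
`n^(2+δ) < bR(⟨n,n,n⟩) ≤ R(⟨n,n,n⟩)` by the gap at `k = max k₀ n₀ ≥ k₀` and
`Literature.Computability.AlgebraicComplexity.algBorderRank_le_tensorRank`. This is exactly the
hypothesis of `SuperquadraticInfinitelyOften`, whose conclusion is `¬ MatrixMultiplication`.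
The cruxes `BeyondCactusWall`, `ThreeByThreeEighteen`, `SingularEntry` and the support `OrbitBound`
are the mechanism's milestones, not hypotheses of the assembly, and are deliberately not used here.
-/

namespace Summit.MatrixMultiplication.MatrixMultiplication.Theorems

open Literature.Computability.AlgebraicComplexity

/-- **Assembly of route `PauliSmithLocalisation` (stmt-MatrixMultiplication-9881), exact signature
`SmithPhaseGap → SuperquadraticInfinitelyOften → ¬ MatrixMultiplication`.** From the phase gap
`p^((2+δ)k) < bR(⟨p^k,p^k,p^k⟩)` (`k ≥ k₀`) and `bR ≤ R` (`algBorderRank_le_tensorRank`) one gets, for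
every `n₀`, the size `n = p^(max k₀ n₀) ≥ n₀` with `n^(2+δ) < R(⟨n,n,n⟩)` — the hypothesis of the
glue `SuperquadraticInfinitelyOften`, which then yields `¬ MatrixMultiplication`. [folklore] -/
theorem pauliSmithLocalisation_assembly_proof :
    Summit.MatrixMultiplication.MatrixMultiplication.Theses.PauliSmithLocalisation.Assembly := by
  unfold Summit.MatrixMultiplication.MatrixMultiplication.Theses.PauliSmithLocalisation.Assembly
    Summit.MatrixMultiplication.MatrixMultiplication.Theses.PauliSmithLocalisation.SmithPhaseGap
    Summit.MatrixMultiplication.MatrixMultiplication.Theses.PauliSmithLocalisation.SuperquadraticInfinitelyOften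
  rintro ⟨p, hp, δ, hδ, k₀, hk⟩ hS
  refine hS ⟨δ, hδ, fun n₀ => ⟨p ^ max k₀ n₀, ?_, ?_⟩⟩
  · exact (le_max_right k₀ n₀).trans (Nat.lt_pow_self hp.one_lt).le
  · exact (hk _ (le_max_left _ _)).trans_le (by exact_mod_cast algBorderRank_le_tensorRank _)

end Summit.MatrixMultiplication.MatrixMultiplication.Theorems
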